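import Summits.QuantumFields.YangMills.Theorems.BalabanUVNodesN12DirectSurjSiteBlockCurved
import Literature.MathematicalPhysics.QuantumFieldTheory.Balaban1983to89.Node00.MultiScaleFibreChartB
import Literature.MathematicalPhysics.QuantumFieldTheory.Balaban1983to89.Node00.MultiScaleFibreChartLagrangeB
import Summits.QuantumFields.YangMills.Theorems.BalabanUVNodesN12FlatChartDerivIterLinB
import Summits.QuantumFields.YangMills.Theorems.BalabanUVNodesN12NearFlatDelta2LetterB
import Summits.QuantumFields.YangMills.Theorems.BalabanUVNodesN12DirectSurjSharpDelta2B
import HarnessLib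

/-!
# DAG node N12 [B15] — (P4)′ road, step (T3ᶜ): A UNIFORM ROW BOUND AND THE CURVED SITE BLOCK (Neumann series on the rows at one inner site) — **BOND-DATUM EDITION** (`…N12DirectSurjSiteBlockCurvedB`, USED DECLARATIONS ONLY)

The print-datum ([Balaban1984PropagatorsII] (2.3)) (γ) twin of `Summits/…/Theorems/BalabanUVNodesN12DirectSurjSiteBlockCurved.lean`: the declarations of the parent whose STATEMENT reads the determining datum
(`exists_curved_siteBlock`, `exists_rowBound`) and which N12's junction of record v14ᴸ uses (dag-n12-c g35 probe-2 census `UsedConstsN12RoadTyped2`, THEOREMS block), re-typed over a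
BOND-LEVEL datum `𝔅 : BDetSet` (F0a `B15DeterminingSetsB`) and dag-n12-c's bond-datum chart `Node00.msChartB` (✓p774329; `msChart 𝐁 = msChartB (bondsDet 𝐁)` by `rfl`).  GENERATOR twin
(this seat's `work/g32/gen_thm.py`, block-extracted from the parent's tree bytes): namespace `…N12DirectSurjSiteBlockCurvedB`, SAME short names, `DetSet ↦ BDetSet`, `AgreeOn 𝐁 ↦ AgreeOnB 𝔅`,
`IsMinimizer ↦ IsMinimizerB`, `bondsOf (𝐁 j) ↦ 𝔅 j`, `msChart ∕ constrCard ∕ constrEnum ∕ ConstrSet ↦ …B`, NODE 00 chart lemmas `…msChart… ↦ …msChartB…`; proofs VERBATIM; the parent's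
datum-free declarations REUSED BY NAME (`open`), never copied (private plumbing excepted, №366 R2).  The parent's (b) statements are the instances `𝔅 := bondsDet 𝐁`.

Cell `pub-ymgap` (HUMAN RULINGS D-0062 ∕ D-0149), seat `pub-ymgap-dag-n12-d` g32 (R134 N12 [B15] s2; the (ii) Theorems-side re-key of N12's road at print's [II] (2.3) datum — director-ym №338 ∕
№343 (E1)(iii-b), FLAG №16 ∕ ruling (α); dag-n12-c DESIGN memo a793b2ebc0b803bf (ii); `N12-ROAD-TWIN-ORDER-2026-08-30.md`).  Count-neutral helper of K1⁹ `stmt-QuantumFields-27364`,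
`--kind proof --supports … --as helper`.  THEOREMS ONLY (0 `def`, 0 `instance`, 0 `sorry`).

HONEST FRAMING (director-ym №338 (5)).  PURELY ADDITIVE: the parent stays landed and true on its own text; nothing in it is edited; no displayed premise of any consumer is deleted or
weakened; every hypothesis of the parent stays a hypothesis.  Nothing of Bałaban's analysis asserted; N12 NOT discharged; K0⁷ ∕ K1⁹ NOT closed; counts unmoved (typed 28∕28 · discharged
8∕27, A 8∕28; K 1∕4); one finite 𝕋⁴ programme at fixed ε — R4 closes the conditional rung `BalabanLadder.UV` only; NOT the Yang–Mills mass gap (Clay); nothing continuum ∕ ℝ⁴ ∕ OS.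

PARENT's DOCSTRING (the mathematics and the citations; read the site-level `𝐁` as the bond datum `𝔅`):
# DAG node N12 [B15] — (P4)′ road, step (T3ᶜ): A UNIFORM ROW BOUND AND THE CURVED SITE BLOCK (Neumann series on the rows at one inner site)

Cell `pub-ymgap` (HUMAN RULINGS D-0062 ∕ D-0149), width seat `pub-ymgap-dag-n12-w6` g6 (director-ym R463-ym; target = dag-n12-c's (P4)′ socket of record, INBOX l.42120).  Key K1⁹
`stmt-QuantumFields-27364`, `--kind proof --supports … --as helper`; count-neutral; THEOREMS ONLY (0 `def`, 0 `sorry`).  Second half of the announced file (split for the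
400-line lint); the first half is `…N12DirectSurjSharpDelta2` ((δ₂)♯ per component + per-component gauge covariance).

CONTENTS.  §4b ★★ `exists_rowBound` — ONE `C, ρ` per height: for `U₀` in the fibre with the guard, a constrained index `i`, a gauge `u` with `U₀^u` `δ`-near-flat on the sharp
tower of row `i` (`δ < ρ`) and any letter `Λ₀` of the FLAT chart derivative, `‖(DΨ_{U₀}(0)X)_i‖ ≤ (Λ₀ + C·δ·Cp)·‖X‖` (the `Λ` of the back-substitution letter).  §5 ★★★
`exists_curved_siteBlock` — from a FLAT site block `Φ` at an inner `(n+1)`-site `y′` (rows at `y′` reproduced exactly at the flat configuration, letter `CΦ`) and a gauge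
flattening the sharp towers of the rows at `y′` to `δ` with `C·δ·Cp·CΦ ≤ ½`: every target on the rows at `y′` is hit EXACTLY by `DΨ_{U₀}(0)X` with `X` supported inside the
support of `Φ` and `‖X‖ ≤ 2·CΦ·‖t‖` (covariance + (δ₂)♯ + the `q = ½` Neumann series `…N12GuardedLinAvgRightInverse.exists_rightInverse_of_approx` on the finite-dimensional
row space at `y′`). [cite: Balaban1985Variational, (153) p.301, (44)-(47) p.285; Balaban1989LargeFieldII, (1.12)-(1.13) p.359]

HONEST FRAMING.  Composition by name; per-height existence constants; nothing of Bałaban's asserted; N12 NOT discharged; K1⁹ NOT closed; count-neutral (typed 28∕28 ·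
discharged 5∕27 unmoved); R4 closes only the conditional finite-`𝕋⁴` rung `BalabanLadder.UV`; the YM mass gap (Clay) is NOT proved by any of this.
-/

noncomputable section

open scoped BigOperators Matrix.Norms.L2Operator Topology
open Filter Finset

namespace Summit.QuantumFields.YangMills.BalabanUVNodes.N12DirectSurjSiteBlockCurvedB

open Literature.MathematicalPhysics.QuantumFieldTheory.Balaban1983to89.B15DeterminingSetsB

open Literature.MathematicalPhysics.QuantumFieldTheory.Balaban1983to89
open T4Continuum (T4Family)
open T4ReflectionConeSharp (TwoBlockLocal twoBlockLocal_blockAvg)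
open BlockAveragingEMLLinearised (linAvg)
open T4AdjointCovarianceUnitary (lieSU)
open B15DeterminingSets
open B14.Eq213DetSet (Bj)
open B5Eq118OneStroke (iterBlockOf iterBlockOf_zero iterBlockOf_succ)
open Node00
open Literature.MathematicalPhysics.QuantumFieldTheory.Balaban1983to89.Node00 (qLin_gaugeAct_avOfRecord smallBelow_gaugeAct)
open Summit.QuantumFields.YangMills.BalabanUVNodes.N12NearFlatDelta2Letter (exists_guard_of_nearFlat)
open Summit.QuantumFields.YangMills.BalabanUVNodes.N12NearFlatDelta2LetterB (exists_delta2_letter)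
open Summit.QuantumFields.YangMills.BalabanUVNodes.N12NearFlatDelta2LetterComponent (fderiv_apply_eq_fderiv_component)
open Summit.QuantumFields.YangMills.BalabanUVNodes.N12DirectSurjSharpDelta2 hiding exists_delta2_letter_component_sharp fderiv_msChart_gaugeAct_apply msChart_apply_eq_of_eqOn_sharp_of_fibre
open Summit.QuantumFields.YangMills.BalabanUVNodes.N12DirectSurjSharpDelta2B (exists_delta2_letter_component_sharp fderiv_msChart_gaugeAct_apply msChart_apply_eq_of_eqOn_sharp_of_fibre)

section
variable {F : T4Family} {N : ℕ} [NeZero N] {K k : ℕ}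

/-- ★ **UNIFORM ROW BOUND.**  ONE `C ≥ 0`, `ρ > 0` per height: for `U₀` in the fibre with the guard, a constrained index `i`, and a gauge `u` with `U₀^u` `δ`-near-flat (`δ < ρ`) on the sharp
tower of row `i`, and any letter `Λ₀` of the FLAT chart derivative `DΦ♭(0)` (which does not depend on `U₀`): `‖(DΨ_{U₀}(0)X)_i‖ ≤ (Λ₀ + C·δ·Cp)·‖X‖` — covariance (§4, `Ad` is an
isometry) + (δ₂)♯ (§3).  This is the `Λ` of the rank-wise back-substitution letter. [cite: Balaban1985Variational, (153) p.301, (44)-(47) p.285; Balaban1989LargeFieldII, (1.12)-(1.13) p.359] -/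
theorem exists_rowBound (k : ℕ)
    (Q : (i : ℕ) → (PBond (F.P K) 0 → Matrix (Fin N) (Fin N) ℂ) → PBond (F.P K) i → Matrix (Fin N) (Fin N) ℂ)
    (hQ0 : ∀ Y, Q 0 Y = Y) (hQs : ∀ (i : ℕ) (Y : PBond (F.P K) 0 → Matrix (Fin N) (Fin N) ℂ) (c : PBond (F.P K) (i + 1)), Q (i + 1) Y c = linAvg (Q i Y) c)
    (p : Seminorm ℝ (PBond (F.P K) 0 → lieSU (Fin N)))
    (hp : ∀ Y : PBond (F.P K) 0 → lieSU (Fin N), ∑ b, ‖(Y b : Matrix (Fin N) (Fin N) ℂ)‖ ^ 2 ≤ p Y ^ 2)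
    {Cp : ℝ} (hCp : 0 ≤ Cp) (hpn : ∀ Y, p Y ≤ Cp * ‖Y‖) :
    ∃ C ρ : ℝ, 0 ≤ C ∧ 0 < ρ ∧
      ∀ (𝔅 : BDetSet (F.P K)) (_ : ∀ j, k < j → 𝔅 j = ∅) (_ : k ≤ (F.P K).m + (F.P K).K) (W : MSField (F.P K) (SU N)) (U₀ : GaugeField (F.P K) 0 (SU N))
        (_ : AgreeOnB 𝔅 (avgFamily (avOfRecord F N K) U₀) W) (_ : SmallBelow (avOfRecord F N K) k U₀) (i : Fin (constrCardB 𝔅 k))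
        (u : GaugeTransf (F.P K) 0 (SU N)) ⦃δ : ℝ⦄ (_ : 0 ≤ δ) (_ : δ < ρ)
        (_ : ∀ b₀ : PBond (F.P K) 0,
          (iterBlockOf (((constrEnumB 𝔅 k).symm i).1 : ℕ) b₀.src = ((constrEnumB 𝔅 k).symm i).2.1.src ∨
            iterBlockOf (((constrEnumB 𝔅 k).symm i).1 : ℕ) b₀.src = ((constrEnumB 𝔅 k).symm i).2.1.tgt) →
          (iterBlockOf (((constrEnumB 𝔅 k).symm i).1 : ℕ) b₀.tgt = ((constrEnumB 𝔅 k).symm i).2.1.src ∨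
            iterBlockOf (((constrEnumB 𝔅 k).symm i).1 : ℕ) b₀.tgt = ((constrEnumB 𝔅 k).symm i).2.1.tgt) →
          ‖((GaugeField.gaugeAct u U₀ b₀ : SU N) : Matrix (Fin N) (Fin N) ℂ) - 1‖ ≤ δ)
        {Λ₀ : ℝ} (_ : 0 ≤ Λ₀)
        (_ : ∀ Y, ‖fderiv ℝ (msChartB F N K k 𝔅 (avgFamily (avOfRecord F N K) (1 : GaugeField (F.P K) 0 (SU N))) (1 : GaugeField (F.P K) 0 (SU N))) 0 Y‖ ≤ Λ₀ * ‖Y‖)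
        (X : PBond (F.P K) 0 → lieSU (Fin N)),
        ‖fderiv ℝ (msChartB F N K k 𝔅 W U₀) 0 X i‖ ≤ (Λ₀ + C * δ * Cp) * ‖X‖ := by
  obtain ⟨C, ρ, hC, hρ, hδ₂⟩ := exists_delta2_letter_component_sharp (F := F) (N := N) (K := K) k Q hQ0 hQs p hp
  refine ⟨C, ρ, hC, hρ, fun 𝔅 h𝔅 hk W U₀ hU hsb i u δ hδ0 hδρ hflat Λ₀ hΛ₀ hΛ X => ?_⟩
  let Ad := fun (g : SU N) => T4AdjointCovarianceUnitary.specialUnitaryAd g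
  let Wu : MSField (F.P K) (SU N) := fun j c => B16Sect1Backgrounds.toMS u j c.src * W j c * (B16Sect1Backgrounds.toMS u j c.tgt)⁻¹
  let Uu : GaugeField (F.P K) 0 (SU N) := GaugeField.gaugeAct u U₀
  let AX : PBond (F.P K) 0 → lieSU (Fin N) := fun b => Ad (u b.tgt) (X b)
  have hsbu : SmallBelow (avOfRecord F N K) k Uu := smallBelow_gaugeAct (P := F.P K) hk u hsb
  have hUu : AgreeOnB 𝔅 (avgFamily (avOfRecord F N K) Uu) Wu := by
    intro j c hc
    by_cases hj : j ≤ k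
    · show Averaging.iter (avOfRecord F N K) j (GaugeField.gaugeAct u U₀) c = _
      rw [B16Sect1Backgrounds.iter_gaugeAct (avOfRecord F N K) u U₀ j (hj.trans hk)]
      show B16Sect1Backgrounds.toMS u j c.src * Averaging.iter (avOfRecord F N K) j U₀ c * (B16Sect1Backgrounds.toMS u j c.tgt)⁻¹ = _
      rw [show Averaging.iter (avOfRecord F N K) j U₀ c = W j c from hU j c hc]
    · exfalso
      rw [h𝔅 j (lt_of_not_ge hj)] at hc
      simp at hc
  have hΨu : DifferentiableAt ℝ (msChartB F N K k 𝔅 Wu Uu) 0 := differentiableAt_msChartB hUu hsbu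
  have hcov := fderiv_msChart_gaugeAct_apply (F := F) h𝔅 hk u hU hsb X i
  have hd := hδ₂ 𝔅 Wu Uu h𝔅 hk hUu hΨu i hδ0 hδρ hflat AX
  have hAXn : ‖AX‖ ≤ ‖X‖ := (pi_norm_le_iff_of_nonneg (norm_nonneg X)).2 fun b => by
    show ‖Ad (u b.tgt) (X b)‖ ≤ ‖X‖
    rw [T4AdjointCovarianceUnitary.norm_specialUnitaryAd]; exact norm_le_pi_norm X b
  have h1 : ‖fderiv ℝ (msChartB F N K k 𝔅 W U₀) 0 X i‖ = ‖fderiv ℝ (msChartB F N K k 𝔅 Wu Uu) 0 AX i‖ := by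
    rw [show fderiv ℝ (msChartB F N K k 𝔅 Wu Uu) 0 AX i = _ from hcov, T4AdjointCovarianceUnitary.norm_specialUnitaryAd]
  rw [h1]
  set Φ1 := fderiv ℝ (msChartB F N K k 𝔅 (avgFamily (avOfRecord F N K) (1 : GaugeField (F.P K) 0 (SU N))) (1 : GaugeField (F.P K) 0 (SU N))) 0 with hΦ1
  calc ‖fderiv ℝ (msChartB F N K k 𝔅 Wu Uu) 0 AX i‖
      ≤ ‖Φ1 AX i‖ + ‖fderiv ℝ (msChartB F N K k 𝔅 Wu Uu) 0 AX i - Φ1 AX i‖ := norm_le_insert' _ _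
    _ ≤ Λ₀ * ‖AX‖ + C * δ * p AX := add_le_add ((norm_le_pi_norm _ i).trans (hΛ AX)) hd
    _ ≤ Λ₀ * ‖X‖ + C * δ * (Cp * ‖X‖) :=
        add_le_add (mul_le_mul_of_nonneg_left hAXn hΛ₀)
          (mul_le_mul_of_nonneg_left ((hpn AX).trans (mul_le_mul_of_nonneg_left hAXn hCp)) (mul_nonneg hC hδ0))
    _ = (Λ₀ + C * δ * Cp) * ‖X‖ := by ring

end

section
variable {F : T4Family} {N : ℕ} [NeZero N] {K k : ℕ}

/-- ★★★ **THE CURVED SITE BLOCK.**  ONE `C ≥ 0`, `ρ > 0` per height (the (δ₂)♯ constants for the seminorm `p`, `p ≤ Cp‖·‖`) such that: for every determining set `𝐁` with no member above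
`k ≤ m + K`, every datum `W` and `U₀` in its fibre with the guard below `k`, every site `y′` of `T^{(n+1)}` (`n + 1 ≤ k`), every REAL-LINEAR FLAT SITE BLOCK `Φ` at `y′`
(`Q^{(n+1)}(↑Φ v)(c) = ↑(v c)` on the rows at `y′`, `‖Φ v‖ ≤ CΦ‖v‖`), and every fine gauge transformation `u` such that `U₀^u` is `δ`-near-flat on the SHARP towers of the rows at `y′`
with `δ < ρ` and `C·δ·Cp·CΦ ≤ 1∕2`: EVERY target on the constrained rows at `y′` is attained EXACTLY by the chart derivative at the CURVED `U₀` on a direction `X` in the `Ad(u)⁻¹`-image of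
the range of `Φ`, with `‖X‖ ≤ 2CΦ·‖t‖` (covariance §4 + (δ₂)♯ §3 + flat identity + dag-n10-w1's `exists_rightInverse_of_approx`).
[cite: Balaban1985Variational, (44)-(48) p.285, (153) p.301; Balaban1989LargeFieldII, p.357, (1.12)-(1.13) p.359; Balaban1988Convergent, (2.10)-(2.13) pp.256-257; Balaban1987RG1, (0.4) p.253] -/
theorem exists_curved_siteBlock (k : ℕ)
    (Q : (i : ℕ) → (PBond (F.P K) 0 → Matrix (Fin N) (Fin N) ℂ) → PBond (F.P K) i → Matrix (Fin N) (Fin N) ℂ)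
    (hQ0 : ∀ Y, Q 0 Y = Y) (hQs : ∀ (i : ℕ) (Y : PBond (F.P K) 0 → Matrix (Fin N) (Fin N) ℂ) (c : PBond (F.P K) (i + 1)), Q (i + 1) Y c = linAvg (Q i Y) c)
    (p : Seminorm ℝ (PBond (F.P K) 0 → lieSU (Fin N)))
    (hp : ∀ Y : PBond (F.P K) 0 → lieSU (Fin N), ∑ b, ‖(Y b : Matrix (Fin N) (Fin N) ℂ)‖ ^ 2 ≤ p Y ^ 2)
    {Cp : ℝ} (hCp : 0 ≤ Cp) (hpn : ∀ Y, p Y ≤ Cp * ‖Y‖) :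
    ∃ C ρ : ℝ, 0 ≤ C ∧ 0 < ρ ∧
      ∀ (𝔅 : BDetSet (F.P K)) (_ : ∀ j, k < j → 𝔅 j = ∅) (_ : k ≤ (F.P K).m + (F.P K).K) (W : MSField (F.P K) (SU N)) (U₀ : GaugeField (F.P K) 0 (SU N))
        (_ : AgreeOnB 𝔅 (avgFamily (avOfRecord F N K) U₀) W) (_ : SmallBelow (avOfRecord F N K) k U₀)
        {n : ℕ} (hn : n + 1 ≤ k) (y' : Site (F.P K) (n + 1))
        (Φ : (PBond (F.P K) (n + 1) → lieSU (Fin N)) →ₗ[ℝ] (PBond (F.P K) 0 → lieSU (Fin N))) {CΦ : ℝ} (_ : 0 ≤ CΦ)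
        (_ : ∀ (v : PBond (F.P K) (n + 1) → lieSU (Fin N)) (c : PBond (F.P K) (n + 1)), (c.src = y' ∨ c.tgt = y') →
          Q (n + 1) (fun b => (Φ v b : Matrix (Fin N) (Fin N) ℂ)) c = (v c : Matrix (Fin N) (Fin N) ℂ))
        (_ : ∀ v, ‖Φ v‖ ≤ CΦ * ‖v‖)
        (u : GaugeTransf (F.P K) 0 (SU N)) ⦃δ : ℝ⦄ (_ : 0 ≤ δ) (_ : δ < ρ) (_ : C * δ * (Cp * CΦ) ≤ 1 / 2)
        (_ : ∀ c : PBond (F.P K) (n + 1), (c.src = y' ∨ c.tgt = y') → ∀ b₀ : PBond (F.P K) 0,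
          (iterBlockOf (n + 1) b₀.src = c.src ∨ iterBlockOf (n + 1) b₀.src = c.tgt) →
          (iterBlockOf (n + 1) b₀.tgt = c.src ∨ iterBlockOf (n + 1) b₀.tgt = c.tgt) →
          ‖((GaugeField.gaugeAct u U₀ b₀ : SU N) : Matrix (Fin N) (Fin N) ℂ) - 1‖ ≤ δ),
      ∀ t : PBond (F.P K) (n + 1) → lieSU (Fin N),
        ∃ X : PBond (F.P K) 0 → lieSU (Fin N),
          (∀ (c : PBond (F.P K) (n + 1)) (hc : c ∈ (𝔅 (n + 1))), (c.src = y' ∨ c.tgt = y') →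
            fderiv ℝ (msChartB F N K k 𝔅 W U₀) 0 X (constrEnumB 𝔅 k ⟨⟨n + 1, Nat.lt_succ_of_le hn⟩, c, hc⟩) = t c) ∧
          (∀ b : PBond (F.P K) 0, X b ≠ 0 → ∃ v, Φ v b ≠ 0) ∧
          ‖X‖ ≤ 2 * CΦ * ‖t‖ := by
  classical
  obtain ⟨C, ρ, hC, hρ, hδ₂⟩ := exists_delta2_letter_component_sharp (F := F) (N := N) (K := K) k Q hQ0 hQs p hp
  refine ⟨C, ρ, hC, hρ, fun 𝔅 h𝔅 hk W U₀ hU hsb n hn y' Φ CΦ hCΦ hΦ hΦn u δ hδ0 hδρ hδC hflat t₀ => ?_⟩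
  -- ### notation
  let S : Type := {c : PBond (F.P K) (n + 1) // c ∈ (𝔅 (n + 1)) ∧ (c.src = y' ∨ c.tgt = y')}
  let ι : S → Fin (constrCardB 𝔅 k) := fun c => constrEnumB 𝔅 k ⟨⟨n + 1, Nat.lt_succ_of_le hn⟩, c.1, c.2.1⟩
  have hι : ∀ c : S, (constrEnumB 𝔅 k).symm (ι c) = ⟨⟨n + 1, Nat.lt_succ_of_le hn⟩, c.1, c.2.1⟩ := fun c => Equiv.symm_apply_apply _ _
  let Ad := fun (g : SU N) => T4AdjointCovarianceUnitary.specialUnitaryAd g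
  let ū : Site (F.P K) (n + 1) → SU N := fun y => B16Sect1Backgrounds.toMS u (n + 1) y
  let Wu : MSField (F.P K) (SU N) := fun j c => B16Sect1Backgrounds.toMS u j c.src * W j c * (B16Sect1Backgrounds.toMS u j c.tgt)⁻¹
  let Uu : GaugeField (F.P K) 0 (SU N) := GaugeField.gaugeAct u U₀
  let Ψ := msChartB F N K k 𝔅 W U₀
  let t : S → lieSU (Fin N) := fun c => t₀ c.1
  have htn : ‖t‖ ≤ ‖t₀‖ := (pi_norm_le_iff_of_nonneg (norm_nonneg t₀)).2 fun c => norm_le_pi_norm t₀ c.1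
  -- ### the transformed pair is guarded and in its fibre
  have hsbu : SmallBelow (avOfRecord F N K) k Uu := smallBelow_gaugeAct (P := F.P K) hk u hsb
  have hUu : AgreeOnB 𝔅 (avgFamily (avOfRecord F N K) Uu) Wu := by
    intro j c hc
    by_cases hj : j ≤ k
    · show Averaging.iter (avOfRecord F N K) j (GaugeField.gaugeAct u U₀) c = _
      rw [B16Sect1Backgrounds.iter_gaugeAct (avOfRecord F N K) u U₀ j (hj.trans hk)]
      show B16Sect1Backgrounds.toMS u j c.src * Averaging.iter (avOfRecord F N K) j U₀ c * (B16Sect1Backgrounds.toMS u j c.tgt)⁻¹ = _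
      rw [show Averaging.iter (avOfRecord F N K) j U₀ c = W j c from hU j c hc]
    · exfalso
      rw [h𝔅 j (lt_of_not_ge hj)] at hc
      simp at hc
  have hΨu : DifferentiableAt ℝ (msChartB F N K k 𝔅 Wu Uu) 0 := differentiableAt_msChartB hUu hsbu
  -- ### the linear maps: the rows at `y′` of the chart derivative; extension by the twisted target; the column candidate
  let T : (PBond (F.P K) 0 → lieSU (Fin N)) →ₗ[ℝ] (S → lieSU (Fin N)) :=
    { toFun := fun X c => fderiv ℝ Ψ 0 X (ι c)
      map_add' := fun X X' => funext fun c => by simp only [map_add, Pi.add_apply]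
      map_smul' := fun r X => funext fun c => by simp only [map_smul, Pi.smul_apply, RingHom.id_apply] }
  let ext : (S → lieSU (Fin N)) →ₗ[ℝ] (PBond (F.P K) (n + 1) → lieSU (Fin N)) :=
    { toFun := fun t c => if h : c ∈ (𝔅 (n + 1)) ∧ (c.src = y' ∨ c.tgt = y') then Ad (ū c.tgt) (t ⟨c, h⟩) else 0
      map_add' := fun t t' => funext fun c => by
        by_cases h : c ∈ (𝔅 (n + 1)) ∧ (c.src = y' ∨ c.tgt = y')
        · simp only [dif_pos h, Pi.add_apply, map_add]
        · simp only [dif_neg h, Pi.add_apply, add_zero]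
      map_smul' := fun r t => funext fun c => by
        by_cases h : c ∈ (𝔅 (n + 1)) ∧ (c.src = y' ∨ c.tgt = y')
        · simp only [dif_pos h, Pi.smul_apply, map_smul, RingHom.id_apply]
        · simp only [dif_neg h, Pi.smul_apply, smul_zero, RingHom.id_apply] }
  have hext : ∀ t (c : S), ext t c.1 = Ad (ū c.1.tgt) (t c) := fun t c => by
    show (if h : c.1 ∈ (𝔅 (n + 1)) ∧ (c.1.src = y' ∨ c.1.tgt = y') then Ad (ū c.1.tgt) (t ⟨c.1, h⟩) else 0) = _
    rw [dif_pos c.2]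
  have hextn : ∀ t, ‖ext t‖ ≤ ‖t‖ := fun t => by
    refine (pi_norm_le_iff_of_nonneg (norm_nonneg t)).2 fun c => ?_
    show ‖(if h : c ∈ (𝔅 (n + 1)) ∧ (c.src = y' ∨ c.tgt = y') then Ad (ū c.tgt) (t ⟨c, h⟩) else 0)‖ ≤ ‖t‖
    by_cases h : c ∈ (𝔅 (n + 1)) ∧ (c.src = y' ∨ c.tgt = y')
    · rw [dif_pos h, T4AdjointCovarianceUnitary.norm_specialUnitaryAd]; exact norm_le_pi_norm t ⟨c, h⟩
    · rw [dif_neg h, norm_zero]; exact norm_nonneg t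
  let Adinv : (PBond (F.P K) 0 → lieSU (Fin N)) →ₗ[ℝ] (PBond (F.P K) 0 → lieSU (Fin N)) :=
    { toFun := fun Y b => Ad (u b.tgt)⁻¹ (Y b)
      map_add' := fun Y Y' => funext fun b => by simp only [Pi.add_apply, map_add]
      map_smul' := fun r Y => funext fun b => by simp only [Pi.smul_apply, map_smul, RingHom.id_apply] }
  have hAdinv : ∀ Y b, Adinv Y b = Ad (u b.tgt)⁻¹ (Y b) := fun _ _ => rfl
  have hAdinvn : ∀ Y, ‖Adinv Y‖ ≤ ‖Y‖ := fun Y =>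
    (pi_norm_le_iff_of_nonneg (norm_nonneg Y)).2 fun b => by
      rw [hAdinv, T4AdjointCovarianceUnitary.norm_specialUnitaryAd]; exact norm_le_pi_norm Y b
  let H₀ : (S → lieSU (Fin N)) →ₗ[ℝ] (PBond (F.P K) 0 → lieSU (Fin N)) := Adinv ∘ₗ Φ ∘ₗ ext
  have hH₀ : ∀ t, H₀ t = Adinv (Φ (ext t)) := fun _ => rfl
  -- `Ad(u) ∘ Adinv = id`
  have hAdAdinv : ∀ Y, (fun b => Ad (u b.tgt) (Adinv Y b)) = Y := fun Y => funext fun b => by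
    rw [hAdinv]
    have := T4AdjointCovarianceUnitary.specialUnitaryAd_inv_apply (u b.tgt)⁻¹ (Y b)
    rw [inv_inv] at this
    exact this
  -- ### the approximation: covariance + (δ₂)♯ + the flat identity
  have happrox : ∀ t, ‖T (H₀ t) - t‖ ≤ (1 / 2) * ‖t‖ := by
    intro t
    have hY := hΦn (ext t)
    refine (pi_norm_le_iff_of_nonneg (by positivity)).2 fun c => ?_
    rw [Pi.sub_apply]
    show ‖fderiv ℝ Ψ 0 (H₀ t) (ι c) - t c‖ ≤ 1 / 2 * ‖t‖
    -- covariance: the transformed chart on `Φ (ext t)` reads `Ad` of the original chart on `H₀ t`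
    have hcov0 := fderiv_msChart_gaugeAct_apply (F := F) h𝔅 hk u hU hsb (H₀ t) (ι c)
    rw [hH₀, hAdAdinv, hι c] at hcov0
    have hcov : fderiv ℝ (msChartB F N K k 𝔅 Wu Uu) 0 (Φ (ext t)) (ι c) = Ad (ū c.1.tgt) (fderiv ℝ Ψ 0 (H₀ t) (ι c)) := hcov0
    -- (δ₂)♯ at the transformed pair, row `ι c`
    have hnear : ∀ b₀ : PBond (F.P K) 0,
        (iterBlockOf (((constrEnumB 𝔅 k).symm (ι c)).1 : ℕ) b₀.src = ((constrEnumB 𝔅 k).symm (ι c)).2.1.src ∨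
          iterBlockOf (((constrEnumB 𝔅 k).symm (ι c)).1 : ℕ) b₀.src = ((constrEnumB 𝔅 k).symm (ι c)).2.1.tgt) →
        (iterBlockOf (((constrEnumB 𝔅 k).symm (ι c)).1 : ℕ) b₀.tgt = ((constrEnumB 𝔅 k).symm (ι c)).2.1.src ∨
          iterBlockOf (((constrEnumB 𝔅 k).symm (ι c)).1 : ℕ) b₀.tgt = ((constrEnumB 𝔅 k).symm (ι c)).2.1.tgt) →
        ‖((Uu b₀ : SU N) : Matrix (Fin N) (Fin N) ℂ) - 1‖ ≤ δ := by
      rw [hι c]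
      exact hflat c.1 c.2.2
    have hd := hδ₂ 𝔅 Wu Uu h𝔅 hk hUu hΨu (ι c) hδ0 hδρ hnear (Φ (ext t))
    -- the flat identity at row `ι c`
    have hflatrow : fderiv ℝ (msChartB F N K k 𝔅 (avgFamily (avOfRecord F N K) (1 : GaugeField (F.P K) 0 (SU N))) (1 : GaugeField (F.P K) 0 (SU N))) 0
        (Φ (ext t)) (ι c) = Ad (ū c.1.tgt) (t c) := by
      rw [Summit.QuantumFields.YangMills.BalabanUVNodes.N12FlatChartDerivIterLinB.fderiv_msChart_one_apply_eq_iterLin Q hQ0 hQs 𝔅 (Φ (ext t)) (ι c), hι c]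
      show suProj N (Q (n + 1) (fun b => (Φ (ext t) b : Matrix (Fin N) (Fin N) ℂ)) c.1) = _
      rw [hΦ (ext t) c.1 c.2.2, suProj_coe, hext]
    rw [hflatrow, hcov, ← map_sub, T4AdjointCovarianceUnitary.norm_specialUnitaryAd] at hd
    calc ‖fderiv ℝ Ψ 0 (H₀ t) (ι c) - t c‖ ≤ C * δ * p (Φ (ext t)) := hd
      _ ≤ C * δ * (Cp * (CΦ * ‖t‖)) := by
          refine mul_le_mul_of_nonneg_left ((hpn _).trans (mul_le_mul_of_nonneg_left (hY.trans ?_) hCp)) (by positivity)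
          exact mul_le_mul_of_nonneg_left (hextn t) hCΦ
      _ = (C * δ * (Cp * CΦ)) * ‖t‖ := by ring
      _ ≤ 1 / 2 * ‖t‖ := mul_le_mul_of_nonneg_right hδC (norm_nonneg _)
  -- ### the Neumann step
  obtain ⟨G, hG, hGn⟩ := Summit.QuantumFields.YangMills.BalabanUVNodes.N12GuardedLinAvgRightInverse.exists_rightInverse_of_approx T H₀ (by norm_num : (1 / 2 : ℝ) < 1) happrox
  refine ⟨H₀ (G t), fun c hc hcy => ?_, fun b hb => ?_, ?_⟩
  · exact congrFun (hG t) ⟨c, hc, hcy⟩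
  · refine ⟨ext (G t), fun h => hb ?_⟩
    rw [hH₀, hAdinv, h, map_zero]
  · rw [hH₀]
    calc ‖Adinv (Φ (ext (G t)))‖ ≤ ‖Φ (ext (G t))‖ := hAdinvn _
      _ ≤ CΦ * ‖ext (G t)‖ := hΦn _
      _ ≤ CΦ * ((1 - 1 / 2)⁻¹ * ‖t‖) := mul_le_mul_of_nonneg_left ((hextn _).trans (hGn t)) hCΦ
      _ = 2 * CΦ * ‖t‖ := by rw [show ((1 : ℝ) - 1 / 2)⁻¹ = 2 by norm_num]; ring
      _ ≤ 2 * CΦ * ‖t₀‖ := mul_le_mul_of_nonneg_left htn (by positivity)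

end

end Summit.QuantumFields.YangMills.BalabanUVNodes.N12DirectSurjSiteBlockCurvedB

end
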